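import Summits.Ventures.PercRepro.C041CutGlueDefs

/-!
# LEMMA G of ROW C-041 — the identity (p6, gen 25; C-041.md §9)

For the glue `glue P ρ₁ ρ₂ Q` of a gadget `P` (states `σ`, reach bits `ρ_t`) and a sub-problem `Q` (patterns `x′`):

  `Φ(glue) = Φ(P) · #_w{x′ : ¬V″} + Σ_{x′ : V″} w′(x′) · (Φ_all(P) + 3·m₁(P, ρ₁)·[G₁″ x′] + 3·m₂(P, ρ₂)·[G₂″ x′])`

— the identity of §9: for a pattern `x′` of the sub-problem that is not valid (hence not Good), the gadget alone
decides everything (`w′ · Φ(P)`); for a valid one every pair is valid and `[G_t^σ ∨ (ρ_t^σ ∧ G_t″)] = [G_t^σ] +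
[¬G_t^σ ∧ ρ_t^σ]·[G_t″]` (`ind_or_and`).  `phi_glue` is the identity; `sum_glue_fixed` its per-`x′` form.
-/

namespace PercRepro

namespace CutGlue

open Finset

variable {Y X : Type*}

/-- The glue's `Good₁`, unfolded. -/
theorem glue_G₁ (P : Space Y) (ρ₁ ρ₂ : Y → Prop) (Q : Space X) (s : Y × X) :
    (glue P ρ₁ ρ₂ Q).G₁ s ↔ P.G₁ s.1 ∨ (ρ₁ s.1 ∧ Q.G₁ s.2) := Iff.rfl

/-- The glue's `Good₂`, unfolded. -/
theorem glue_G₂ (P : Space Y) (ρ₁ ρ₂ : Y → Prop) (Q : Space X) (s : Y × X) :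
    (glue P ρ₁ ρ₂ Q).G₂ s ↔ P.G₂ s.1 ∨ (ρ₂ s.1 ∧ Q.G₂ s.2) := Iff.rfl

/-- The glue's validity, unfolded. -/
theorem glue_V (P : Space Y) (ρ₁ ρ₂ : Y → Prop) (Q : Space X) (s : Y × X) :
    (glue P ρ₁ ρ₂ Q).V s ↔ P.V s.1 ∨ Q.V s.2 := Iff.rfl

/-- The glue's weight, unfolded. -/
theorem glue_w (P : Space Y) (ρ₁ ρ₂ : Y → Prop) (Q : Space X) (s : Y × X) :
    (glue P ρ₁ ρ₂ Q).w s = P.w s.1 * Q.w s.2 := rfl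

/-- The weight of a pair: `wt(σ, x′) = wt(σ) + 3·[¬G₁^σ ∧ ρ₁^σ]·[G₁″] + 3·[¬G₂^σ ∧ ρ₂^σ]·[G₂″]`. -/
theorem glue_wt (P : Space Y) (ρ₁ ρ₂ : Y → Prop) (Q : Space X) (σ : Y) (x : X) :
    (glue P ρ₁ ρ₂ Q).wt (σ, x) =
      P.wt σ + 3 * ind (¬ P.G₁ σ ∧ ρ₁ σ) * ind (Q.G₁ x) + 3 * ind (¬ P.G₂ σ ∧ ρ₂ σ) * ind (Q.G₂ x) := by
  show 3 * ind (P.G₁ σ ∨ (ρ₁ σ ∧ Q.G₁ x)) + 3 * ind (P.G₂ σ ∨ (ρ₂ σ ∧ Q.G₂ x)) - 2 = _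
  unfold Space.wt
  rw [ind_or_and, ind_or_and]
  ring

/-- A pair with an invalid sub-problem pattern has the gadget's weight. -/
theorem glue_wt_of_not_V (P : Space Y) (ρ₁ ρ₂ : Y → Prop) (Q : Space X) (σ : Y) {x : X} (hx : ¬ Q.V x) :
    (glue P ρ₁ ρ₂ Q).wt (σ, x) = P.wt σ := by
  rw [glue_wt, ind_neg (fun h => hx (Q.hG₁ x h)), ind_neg (fun h => hx (Q.hG₂ x h))]
  ring

variable [Fintype Y] [Fintype X]

omit [Fintype X] in
open Classical in
/-- **The per-pattern sum**: for a fixed sub-problem pattern `x′`, the sum over the gadget states. -/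
theorem sum_glue_fixed (P : Space Y) (ρ₁ ρ₂ : Y → Prop) (Q : Space X) (x : X) :
    (∑ σ, if (glue P ρ₁ ρ₂ Q).V (σ, x) then ((glue P ρ₁ ρ₂ Q).w (σ, x) : ℤ) * (glue P ρ₁ ρ₂ Q).wt (σ, x) else 0)
      = if Q.V x then
          (Q.w x : ℤ) * (P.phiAll + 3 * P.m₁ ρ₁ * ind (Q.G₁ x) + 3 * P.m₂ ρ₂ * ind (Q.G₂ x))
        else (Q.w x : ℤ) * P.phi := by
  by_cases hx : Q.V x
  · rw [if_pos hx]
    have hterm : ∀ σ, (if (glue P ρ₁ ρ₂ Q).V (σ, x) then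
          ((glue P ρ₁ ρ₂ Q).w (σ, x) : ℤ) * (glue P ρ₁ ρ₂ Q).wt (σ, x) else 0)
        = (Q.w x : ℤ) * ((P.w σ : ℤ) * P.wt σ
            + 3 * (ind (¬ P.G₁ σ ∧ ρ₁ σ) * (P.w σ : ℤ)) * ind (Q.G₁ x)
            + 3 * (ind (¬ P.G₂ σ ∧ ρ₂ σ) * (P.w σ : ℤ)) * ind (Q.G₂ x)) := by
      intro σ
      rw [if_pos ((glue_V P ρ₁ ρ₂ Q (σ, x)).2 (Or.inr hx)), glue_wt, glue_w]
      push_cast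
      ring
    rw [Finset.sum_congr rfl (fun σ _ => hterm σ), ← Finset.mul_sum]
    congr 1
    rw [Finset.sum_add_distrib, Finset.sum_add_distrib]
    unfold Space.phiAll Space.m₁ Space.m₂ Space.cnt
    simp only [ite_eq_ind_mul]
    rw [← Finset.sum_mul, ← Finset.mul_sum, ← Finset.sum_mul, ← Finset.mul_sum]
  · rw [if_neg hx]
    have hterm : ∀ σ, (if (glue P ρ₁ ρ₂ Q).V (σ, x) then
          ((glue P ρ₁ ρ₂ Q).w (σ, x) : ℤ) * (glue P ρ₁ ρ₂ Q).wt (σ, x) else 0)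
        = (Q.w x : ℤ) * (if P.V σ then (P.w σ : ℤ) * P.wt σ else 0) := by
      intro σ
      by_cases hσ : P.V σ
      · rw [if_pos ((glue_V P ρ₁ ρ₂ Q (σ, x)).2 (Or.inl hσ)), if_pos hσ, glue_wt_of_not_V P ρ₁ ρ₂ Q σ hx,
          glue_w]
        push_cast
        ring
      · have hV : ¬ (glue P ρ₁ ρ₂ Q).V (σ, x) := fun h => by
          rcases (glue_V P ρ₁ ρ₂ Q (σ, x)).1 h with h | h
          · exact hσ h
          · exact hx h
        rw [if_neg hV, if_neg hσ, mul_zero]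
    rw [Finset.sum_congr rfl (fun σ _ => hterm σ), ← Finset.mul_sum]
    rfl

open Classical in
/-- **THE IDENTITY OF LEMMA G** (C-041.md §9): `Φ(glue) = Φ(P)·#_w{¬V″} + Σ_{V″} w′·(Φ_all(P) + 3·m₁·[G₁″] +
3·m₂·[G₂″])`. -/
theorem phi_glue (P : Space Y) (ρ₁ ρ₂ : Y → Prop) (Q : Space X) :
    (glue P ρ₁ ρ₂ Q).phi = P.phi * Q.NnotV + ∑ x, (if Q.V x then
        (Q.w x : ℤ) * (P.phiAll + 3 * P.m₁ ρ₁ * ind (Q.G₁ x) + 3 * P.m₂ ρ₂ * ind (Q.G₂ x)) else 0) := by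
  conv_lhs => unfold Space.phi
  rw [Fintype.sum_prod_type_right, Finset.sum_congr rfl (fun x _ => sum_glue_fixed P ρ₁ ρ₂ Q x)]
  unfold Space.NnotV Space.cnt
  rw [Finset.mul_sum, ← Finset.sum_add_distrib]
  apply Finset.sum_congr rfl
  intro x _
  by_cases hx : Q.V x
  · rw [if_pos hx, if_neg (not_not.2 hx), if_pos hx]
    ring
  · rw [if_neg hx, if_pos hx, if_neg hx]
    ring

end CutGlue

end PercRepro
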